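import Mathlib.NumberTheory.NumberField.DedekindZeta
import Mathlib.NumberTheory.LSeries.Deriv
import Mathlib.NumberTheory.LSeries.Convolution
import Mathlib.NumberTheory.LSeries.Positivity
import Mathlib.RingTheory.DedekindDomain.Factorization
import Mathlib.Analysis.Complex.HasPrimitives
import Literature.NumberTheory.LFunctions.PrimeIdealPsi
import Literature.NumberTheory.LFunctions.DedekindZeta
import Literature.NumberTheory.LFunctions.IdealNormCount
import HarnessLib

/-!
# `−ζ_K'/ζ_K = ∑ Λ_K(n) n⁻ˢ` and the non-vanishing of `ζ_K` on `σ > 1`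

Topic `Literature/NumberTheory/LFunctions` (sibling of `DedekindZeta.lean`, `PrimeIdealPsi.lean`).
Third brick, bottom-up, of the decomposition of the named fact `Literature.NumberTheory.LFunctions.NumberField.primeIdealTheorem`
(Landau 1903): the *Dirichlet-series side* of Landau's Part II §11 (p. 668), where the logarithmic
derivative of `ζ_κ(s)` is expanded as `−ζ_κ'/ζ_κ(s) = ∑ₙ L_κ(n) n⁻ˢ` with `L_κ(n) = Λ_K(n)` the
von Mangoldt weight of `PrimeIdealPsi.lean` (`vonMangoldtIdeal K n = ∑_{N𝔭^m = n} log N𝔭`).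
Everything here is PROVED (no named facts), for Mathlib's Dirichlet series
`NumberField.dedekindZeta K = LSeries (n ↦ #{𝔞 : N𝔞 = n})` (coefficients `a_n = idealNormCount K n`
of `IdealNormCount.lean`), and *without* the Euler product
(which the tree only has as the named fact `Literature.NumberField.hasProd_dedekindEulerFactor`):

* `sum_divisorsAntidiagonal_card_mul_vonMangoldtIdeal` — the coefficient identity
  `∑_{de = n} a_d Λ_K(e) = a_n log n` (`a_n = #{𝔞 : N𝔞 = n}`), i.e. `a ⋆ Λ_K = a · log`
  (`idealNormCount_convolution_vonMangoldtIdeal`), from unique factorisation of ideals through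
  `log N𝔞 = ∑_𝔭 v_𝔭(𝔞) log N𝔭` (`log_absNorm_eq_sum_multiplicity`) and a double counting of the
  pairs `(𝔞, 𝔭^m)` with `𝔭^m ∣ 𝔞`, `N𝔞 = n` (`card_filter_pow_dvd`, `sum_multiplicity_eq_sum_card`).
* `LSeriesSummable_vonMangoldtIdeal` — `∑ Λ_K(n) n⁻ˢ` converges absolutely for `σ > 1`
  (`0 ≤ Λ_K(n) ≤ a_n log n`); `vonMangoldtIdeal_one` (`Λ_K(1) = 0`).
* `hasDerivAt_dedekindZeta` / `deriv_dedekindZeta_eq` — `ζ_K'(s) = −ζ_K(s) · ∑ Λ_K(n) n⁻ˢ`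
  for `σ > 1` (Mathlib's `LSeries_hasDerivAt` and `LSeries_convolution'`).
* `dedekindZeta_pos` (`ζ_K(x) > 0` for real `x > 1`) and `dedekindZeta_ne_zero_of_one_lt_re` —
  `ζ_K(s) ≠ 0` for `σ > 1`, proved from the linear ODE `f' = −L f` (a zero would propagate to
  `ζ_K ≡ 0` by the identity theorem; Mathlib's `DifferentiableOn.isExactOn_ball` supplies the
  primitive of `L` on a disc), and `neg_logDeriv_dedekindZeta_eq`
  (`−ζ_K'/ζ_K(s) = ∑ Λ_K(n) n⁻ˢ`, the form printed by Landau).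

These are the inputs "`Λ_K ≥ 0`, `−ζ_K'/ζ_K = ∑ Λ_K n⁻ˢ`" of the de la Vallée-Poussin method
(zero-free region, Montgomery–Vaughan §6.1, applied to `ζ_K` on their p. 267).

## References

* E. Landau, *Neuer Beweis des Primzahlsatzes und Beweis des Primidealsatzes*, Math. Ann. 56
  (1903), 645–670, Part II §11, p. 668 (`LandauMathAnn1903`).
* H. L. Montgomery, R. C. Vaughan, *Multiplicative Number Theory I. Classical Theory*,
  Cambridge Stud. Adv. Math. 97 (2007), p. 267 (`MontgomeryVaughan2007`).
-/

noncomputable section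

open scoped NumberField LSeries.notation ComplexOrder
open Finset

namespace Literature.NumberTheory.LFunctions.NumberField

variable (K : Type*) [Field K] [NumberField K]

/-! ### Ideals of a given norm -/

/-- The finset of ideals of `𝓞 K` of absolute norm `n` (Mathlib's `Ideal.finite_setOf_absNorm_eq`);
its cardinality is `idealNormCount K n` (`card_idealsOfNorm`). Junk value at `n = 0`:
`idealsOfNorm K 0 = {⊥}` (only the zero ideal has norm `0`), matching `idealNormCount K 0 = 1`.
[folklore] -/
def idealsOfNorm (n : ℕ) : Finset (Ideal (𝓞 K)) :=
  (Ideal.finite_setOf_absNorm_eq (S := 𝓞 K) n).toFinset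

variable {K} in
/-- Membership in `idealsOfNorm K n`. [folklore] -/
@[simp] theorem mem_idealsOfNorm {n : ℕ} {I : Ideal (𝓞 K)} :
    I ∈ idealsOfNorm K n ↔ Ideal.absNorm I = n := by
  simp [idealsOfNorm]

/-- `#(idealsOfNorm K n) = a_n = idealNormCount K n`, the `n`-th coefficient of Mathlib's
`NumberField.dedekindZeta K` (`Literature.NumberTheory.LFunctions.dedekindZeta_eq_LSeries`). [folklore] -/
theorem card_idealsOfNorm (n : ℕ) : (idealsOfNorm K n).card = idealNormCount K n := by
  rw [idealNormCount, idealsOfNorm, ← Set.ncard_eq_toFinset_card _ (Ideal.finite_setOf_absNorm_eq n),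
    ← Nat.card_coe_set_eq]
  rfl

/-- `a_1 = 1`: only the unit ideal has norm `1`. [folklore] -/
theorem idealsOfNorm_one : idealsOfNorm K 1 = {⊤} := by
  ext I
  simp [Ideal.absNorm_eq_one_iff]

variable {K}

/-- Membership in the finset of prime ideals of norm `≤ x`. [folklore] -/
theorem mem_primeIdealsLE_toFinset {x : ℝ} {P : Ideal (𝓞 K)} :
    P ∈ (finite_primeIdealsLE K x).toFinset ↔ P.IsPrime ∧ P ≠ ⊥ ∧ (Ideal.absNorm P : ℝ) ≤ x := by
  simp [primeIdealsLE]

/-! ### `log N(I) = ∑_P v_P(I) log N(P)` -/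

/-- For a nonzero ideal `I` with `N(I) ≤ B`: `log N(I) = ∑_{P prime, N P ≤ B} v_P(I) · log N(P)`,
where `v_P(I) = multiplicity P I` (unique factorisation of ideals). [folklore] -/
theorem log_absNorm_eq_sum_multiplicity {B : ℕ} {I : Ideal (𝓞 K)} (hI : I ≠ ⊥)
    (hIB : Ideal.absNorm I ≤ B) :
    Real.log (Ideal.absNorm I) =
      ∑ P ∈ (finite_primeIdealsLE K B).toFinset,
        (multiplicity P I : ℝ) * Real.log (Ideal.absNorm P) := by
  induction I using UniqueFactorizationMonoid.induction_on_prime with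
  | h₁ => exact absurd (Submodule.zero_eq_bot (M := 𝓞 K)) hI
  | h₂ J hJ =>
    rw [Ideal.isUnit_iff] at hJ
    subst hJ
    rw [Ideal.absNorm_top, Nat.cast_one, Real.log_one, eq_comm]
    refine sum_eq_zero fun P hP => ?_
    rw [mem_primeIdealsLE_toFinset] at hP
    have : ¬ IsUnit P := fun h => hP.1.ne_top (Ideal.isUnit_iff.mp h)
    rw [multiplicity_of_isUnit_right this (Ideal.isUnit_iff.mpr rfl), Nat.cast_zero, zero_mul]
  | h₃ J p hJ hp ih =>
    have hJ' : J ≠ ⊥ := hJ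
    have hp0 : p ≠ ⊥ := hp.ne_zero
    have hNp : Ideal.absNorm p ≠ 0 := by rwa [Ne, Ideal.absNorm_eq_zero_iff]
    have hNJ : Ideal.absNorm J ≠ 0 := by rwa [Ne, Ideal.absNorm_eq_zero_iff]
    rw [map_mul] at hIB ⊢
    have hJB : Ideal.absNorm J ≤ B :=
      le_trans (Nat.le_mul_of_pos_left _ (Nat.pos_of_ne_zero hNp)) hIB
    have hpB : Ideal.absNorm p ≤ B :=
      le_trans (Nat.le_mul_of_pos_right _ (Nat.pos_of_ne_zero hNJ)) hIB
    have hpmem : p ∈ (finite_primeIdealsLE K B).toFinset :=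
      mem_primeIdealsLE_toFinset.mpr ⟨Ideal.isPrime_of_prime hp, hp0, by exact_mod_cast hpB⟩
    rw [Nat.cast_mul, Real.log_mul (by exact_mod_cast hNp) (by exact_mod_cast hNJ), ih hJ' hJB]
    have hmul : ∀ P ∈ (finite_primeIdealsLE K B).toFinset,
        (multiplicity P (p * J) : ℝ) * Real.log (Ideal.absNorm P) =
          (if P = p then Real.log (Ideal.absNorm P) else 0) +
            (multiplicity P J : ℝ) * Real.log (Ideal.absNorm P) := by
      intro P hP
      rw [mem_primeIdealsLE_toFinset] at hP
      have hPp : Prime P := Ideal.prime_of_isPrime hP.2.1 hP.1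
      have hfin : FiniteMultiplicity P (p * J) :=
        FiniteMultiplicity.of_prime_left hPp (mul_ne_zero hp.ne_zero hJ)
      rw [multiplicity_mul hPp hfin, Nat.cast_add, add_mul]
      congr 1
      split_ifs with h
      · subst h
        rw [multiplicity_self, Nat.cast_one, one_mul]
      · rw [multiplicity_eq_zero.mpr, Nat.cast_zero, zero_mul]
        intro hdvd
        exact h (associated_iff_eq.mp (hPp.associated_of_dvd hp hdvd))
    rw [sum_congr rfl hmul, sum_add_distrib, sum_ite_eq' _ p, if_pos hpmem]

/-! ### Counting ideals of norm `n` divisible by `P^m` -/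

section Classical

open scoped Classical

/-- The ideals of norm `n` divisible by `P^m` are in bijection with the ideals of norm `n / N(P)^m`
(when `N(P)^m ∣ n`; otherwise there are none). [folklore] -/
theorem card_filter_pow_dvd (n : ℕ) {P : Ideal (𝓞 K)} (hP0 : P ≠ ⊥) (m : ℕ) :
    ((idealsOfNorm K n).filter (fun I => P ^ m ∣ I)).card =
      if Ideal.absNorm P ^ m ∣ n then (idealsOfNorm K (n / Ideal.absNorm P ^ m)).card else 0 := by
  have hNP : Ideal.absNorm P ≠ 0 := by rwa [Ne, Ideal.absNorm_eq_zero_iff]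
  have hq0 : Ideal.absNorm P ^ m ≠ 0 := pow_ne_zero _ hNP
  split_ifs with h
  · obtain ⟨q, hq⟩ := h
    have hdiv : n / Ideal.absNorm P ^ m = q := by
      rw [hq, Nat.mul_div_cancel_left _ (Nat.pos_of_ne_zero hq0)]
    have hset : (idealsOfNorm K n).filter (fun I => P ^ m ∣ I) =
        (idealsOfNorm K q).image (fun J => P ^ m * J) := by
      ext I
      simp only [mem_filter, mem_image, mem_idealsOfNorm]
      constructor
      · rintro ⟨hI, J, rfl⟩
        refine ⟨J, ?_, rfl⟩
        rw [map_mul, map_pow, hq] at hI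
        exact Nat.eq_of_mul_eq_mul_left (Nat.pos_of_ne_zero hq0) hI
      · rintro ⟨J, hJ, rfl⟩
        exact ⟨by rw [map_mul, map_pow, hJ, hq], dvd_mul_right _ _⟩
    rw [hdiv, hset, card_image_of_injective _ (mul_right_injective₀ (pow_ne_zero m ?_))]
    rw [Ne, Ideal.zero_eq_bot]; exact hP0
  · rw [Finset.card_eq_zero, filter_eq_empty_iff]
    intro I hI hdvd
    apply h
    rw [mem_idealsOfNorm] at hI
    rw [← hI, ← map_pow]
    exact map_dvd Ideal.absNorm hdvd

/-- For an ideal `I` of norm `n ≠ 0` and a nonzero prime `P`: `v_P(I) = #{m ∈ [1, n] : P^m ∣ I}`.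
[folklore] -/
theorem multiplicity_eq_card_filter {n : ℕ} (hn : n ≠ 0) {I : Ideal (𝓞 K)}
    (hI : Ideal.absNorm I = n) {P : Ideal (𝓞 K)} (hP : P.IsPrime) (hP0 : P ≠ ⊥) :
    multiplicity P I = ((Icc 1 n).filter (fun m => P ^ m ∣ I)).card := by
  have hI0 : I ≠ ⊥ := by
    rintro rfl
    rw [Ideal.absNorm_bot] at hI
    exact hn hI.symm
  have hPp : Prime P := Ideal.prime_of_isPrime hP0 hP
  have hfin : FiniteMultiplicity P I := FiniteMultiplicity.of_prime_left hPp hI0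
  have hNP : 2 ≤ Ideal.absNorm P := by
    have h0 : Ideal.absNorm P ≠ 0 := by rwa [Ne, Ideal.absNorm_eq_zero_iff]
    have h1 : Ideal.absNorm P ≠ 1 := by
      rw [Ne, Ideal.absNorm_eq_one_iff]; exact hP.ne_top
    omega
  -- `multiplicity ≤ n`
  have hle : multiplicity P I ≤ n := by
    have hd : P ^ multiplicity P I ∣ I := pow_multiplicity_dvd P I
    have h1 : Ideal.absNorm P ^ multiplicity P I ∣ n := by
      rw [← hI, ← map_pow]; exact map_dvd Ideal.absNorm hd
    have h2 : Ideal.absNorm P ^ multiplicity P I ≤ n := Nat.le_of_dvd (Nat.pos_of_ne_zero hn) h1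
    have h3 : 2 ^ multiplicity P I ≤ Ideal.absNorm P ^ multiplicity P I :=
      Nat.pow_le_pow_left hNP _
    have h4 : multiplicity P I < 2 ^ multiplicity P I := Nat.lt_two_pow_self
    exact (h4.trans_le (h3.trans h2)).le
  have hset : (Icc 1 n).filter (fun m => P ^ m ∣ I) = Icc 1 (multiplicity P I) := by
    ext m
    simp only [mem_filter, mem_Icc, hfin.pow_dvd_iff_le_multiplicity]
    omega
  rw [hset, Nat.card_Icc]
  omega

/-- Double counting: `∑_{N I = n} v_P(I) = ∑_{m=1}^{n} #{I : N I = n, P^m ∣ I}`. [folklore] -/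
theorem sum_multiplicity_eq_sum_card {n : ℕ} (hn : n ≠ 0) {P : Ideal (𝓞 K)} (hP : P.IsPrime)
    (hP0 : P ≠ ⊥) :
    ∑ I ∈ idealsOfNorm K n, (multiplicity P I : ℝ) =
      ∑ m ∈ Icc 1 n, (((idealsOfNorm K n).filter (fun I => P ^ m ∣ I)).card : ℝ) := by
  have h1 : ∀ I ∈ idealsOfNorm K n, (multiplicity P I : ℝ) =
      ∑ m ∈ Icc 1 n, if P ^ m ∣ I then (1 : ℝ) else 0 := by
    intro I hI
    rw [multiplicity_eq_card_filter hn (mem_idealsOfNorm.mp hI) hP hP0, sum_boole]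
  rw [sum_congr rfl h1, sum_comm]
  refine sum_congr rfl fun m _ => ?_
  rw [sum_boole]

end Classical

/-! ### The convolution identity `a * Λ_K = a · log` -/

/-- Uniqueness of the exponent: for `q ≥ 2` and `e ≤ n`,
`(if e ∈ {q^m : 1 ≤ m ≤ e} then c else 0) = ∑_{m=1}^{n} (if q^m = e then c else 0)`. [folklore] -/
theorem ite_mem_image_pow_eq_sum {q e n : ℕ} (hq : 2 ≤ q) (hen : e ≤ n) (c : ℝ) :
    (if e ∈ (Icc 1 e).image (fun m => q ^ m) then c else 0) =
      ∑ m ∈ Icc 1 n, if q ^ m = e then c else 0 := by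
  have hinj : Function.Injective (fun m : ℕ => q ^ m) := Nat.pow_right_injective hq
  split_ifs with h
  · obtain ⟨m, hm, hme⟩ := mem_image.mp h
    have hmn : m ∈ Icc 1 n := by
      rw [mem_Icc] at hm ⊢; omega
    rw [← sum_filter, show (Icc 1 n).filter (fun k => q ^ k = e) = {m} from ?_, sum_singleton]
    ext k
    simp only [mem_filter, mem_singleton]
    constructor
    · rintro ⟨-, hk⟩
      exact hinj (hk.trans hme.symm)
    · rintro rfl
      exact ⟨hmn, hme⟩
  · rw [eq_comm]
    refine sum_eq_zero fun m hm => ?_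
    rw [if_neg]
    intro hme
    apply h
    refine mem_image.mpr ⟨m, ?_, hme⟩
    rw [mem_Icc] at hm ⊢
    refine ⟨hm.1, ?_⟩
    have : m < q ^ m := (Nat.lt_two_pow_self).trans_le (Nat.pow_le_pow_left hq _)
    omega

/-- **`∑_{de = n} a_d Λ_K(e) = a_n log n`** (`n ≥ 1`): the Dirichlet-coefficient form of
`−ζ_K'(s) = ζ_K(s) · ∑ Λ_K(n) n^{-s}`; both sides equal `∑_{N I = n} log N(I)` computed through
`log N(I) = ∑_P v_P(I) log N P` (Landau 1903, §11: `−ζ_κ'/ζ_κ = ∑ L_κ(n) n^{-s}`).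
[cite: LandauMathAnn1903, §11 p. 668] -/
theorem sum_divisorsAntidiagonal_card_mul_vonMangoldtIdeal {n : ℕ} (hn : n ≠ 0) :
    ∑ p ∈ n.divisorsAntidiagonal, ((idealsOfNorm K p.1).card : ℝ) * vonMangoldtIdeal K p.2 =
      (idealsOfNorm K n).card * Real.log n := by
  set S := (finite_primeIdealsLE K n).toFinset with hS
  -- RHS = ∑_{P ∈ S} log N P · ∑_{I} v_P(I)
  have hR : ((idealsOfNorm K n).card : ℝ) * Real.log n =
      ∑ P ∈ S, Real.log (Ideal.absNorm P) * ∑ I ∈ idealsOfNorm K n, (multiplicity P I : ℝ) := by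
    calc ((idealsOfNorm K n).card : ℝ) * Real.log n
        = ∑ I ∈ idealsOfNorm K n, Real.log (Ideal.absNorm I) := by
          rw [sum_congr rfl fun I hI => by rw [mem_idealsOfNorm.mp hI], sum_const, nsmul_eq_mul]
      _ = ∑ I ∈ idealsOfNorm K n, ∑ P ∈ S, (multiplicity P I : ℝ) * Real.log (Ideal.absNorm P) := by
          refine sum_congr rfl fun I hI => ?_
          have hIn := mem_idealsOfNorm.mp hI
          have hI0 : I ≠ ⊥ := by
            rintro rfl
            rw [Ideal.absNorm_bot] at hIn
            exact hn hIn.symm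
          exact log_absNorm_eq_sum_multiplicity hI0 hIn.le
      _ = ∑ P ∈ S, Real.log (Ideal.absNorm P) * ∑ I ∈ idealsOfNorm K n, (multiplicity P I : ℝ) := by
          rw [sum_comm]
          refine sum_congr rfl fun P _ => ?_
          rw [mul_sum]
          refine sum_congr rfl fun I _ => ?_
          ring
  -- LHS = ∑_{P ∈ S} ∑_{(d,e)} a_d · (if e ∈ image then log N P else 0)
  have hL : ∑ p ∈ n.divisorsAntidiagonal, ((idealsOfNorm K p.1).card : ℝ) * vonMangoldtIdeal K p.2 =
      ∑ P ∈ S, ∑ p ∈ n.divisorsAntidiagonal, ((idealsOfNorm K p.1).card : ℝ) *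
        (if p.2 ∈ (Icc 1 p.2).image (fun m => Ideal.absNorm P ^ m) then
          Real.log (Ideal.absNorm P) else 0) := by
    rw [sum_comm]
    refine sum_congr rfl fun p hp => ?_
    rw [← mul_sum]
    congr 1
    unfold vonMangoldtIdeal
    obtain ⟨hpn, -⟩ := Nat.mem_divisorsAntidiagonal.mp hp
    have he0 : p.2 ≠ 0 := right_ne_zero_of_mul (hpn ▸ hn)
    have hen : p.2 ≤ n := Nat.le_of_dvd (Nat.pos_of_ne_zero hn) (Dvd.intro_left _ hpn)
    -- extend the range of summation from `S_{e}` to `S_n`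
    have hsub : (finite_primeIdealsLE K p.2).toFinset ⊆ S := by
      intro P hP
      rw [mem_primeIdealsLE_toFinset] at hP ⊢
      exact ⟨hP.1, hP.2.1, hP.2.2.trans (by exact_mod_cast hen)⟩
    refine (sum_subset hsub fun P hPS hPe => ?_)
    rw [if_neg]
    intro hmem
    apply hPe
    rw [mem_primeIdealsLE_toFinset] at hPS ⊢
    refine ⟨hPS.1, hPS.2.1, ?_⟩
    obtain ⟨m, hm, hme⟩ := mem_image.mp hmem
    have h1 : 1 ≤ m := (mem_Icc.mp hm).1
    have hNP : Ideal.absNorm P ≤ Ideal.absNorm P ^ m := by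
      calc Ideal.absNorm P = Ideal.absNorm P ^ 1 := (pow_one _).symm
        _ ≤ Ideal.absNorm P ^ m := Nat.pow_le_pow_right (Nat.pos_of_ne_zero (by
            rw [Ne, Ideal.absNorm_eq_zero_iff]; exact hPS.2.1)) h1
    exact_mod_cast hNP.trans hme.le
  rw [hL, hR]
  refine sum_congr rfl fun P hP => ?_
  rw [hS, mem_primeIdealsLE_toFinset] at hP
  obtain ⟨hPpr, hP0, -⟩ := hP
  have hNP2 : 2 ≤ Ideal.absNorm P := by
    have h0 : Ideal.absNorm P ≠ 0 := by rwa [Ne, Ideal.absNorm_eq_zero_iff]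
    have h1 : Ideal.absNorm P ≠ 1 := by
      rw [Ne, Ideal.absNorm_eq_one_iff]; exact hPpr.ne_top
    omega
  set q := Ideal.absNorm P with hq
  set c := Real.log (q : ℝ) with hc
  -- rewrite the indicator through the (unique) exponent `m ∈ [1, n]`
  have h1 : ∀ p ∈ n.divisorsAntidiagonal,
      ((idealsOfNorm K p.1).card : ℝ) *
          (if p.2 ∈ (Icc 1 p.2).image (fun m => q ^ m) then c else 0) =
        ∑ m ∈ Icc 1 n, ((idealsOfNorm K p.1).card : ℝ) * (if q ^ m = p.2 then c else 0) := by
    intro p hp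
    obtain ⟨hpn, -⟩ := Nat.mem_divisorsAntidiagonal.mp hp
    have hen : p.2 ≤ n := Nat.le_of_dvd (Nat.pos_of_ne_zero hn) (Dvd.intro_left _ hpn)
    rw [ite_mem_image_pow_eq_sum hNP2 hen c, mul_sum]
  rw [sum_congr rfl h1, sum_comm, sum_multiplicity_eq_sum_card hn hPpr hP0, mul_sum]
  refine sum_congr rfl fun m _ => ?_
  -- ∑_{(d,e)} a_d (if q^m = e then c else 0) = c · #{I : N I = n, P^m ∣ I}
  rw [Nat.sum_divisorsAntidiagonal' (fun d e => ((idealsOfNorm K d).card : ℝ) *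
      (if q ^ m = e then c else 0)),
    card_filter_pow_dvd n hP0 m]
  simp_rw [mul_ite, mul_zero]
  simp_rw [show ∀ x : ℕ, (q ^ m = x) ↔ (x = q ^ m) from fun x => eq_comm, sum_ite_eq' n.divisors]
  rw [Nat.cast_ite, Nat.cast_zero]
  by_cases hd : q ^ m ∣ n
  · rw [if_pos (Nat.mem_divisors.mpr ⟨hd, hn⟩), if_pos hd, mul_comm]
  · rw [if_neg (fun h => hd (Nat.mem_divisors.mp h).1), if_neg hd, mul_zero]

/-! ### The Dirichlet series `−ζ_K'/ζ_K = ∑ Λ_K(n) n^{-s}` -/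

variable (K)

/-- `a_n ≥ 0` for the coefficients `a_n = idealNormCount K n` of `ζ_K`, as a complex sequence.
[folklore] -/
theorem idealNormCount_cast_nonneg : 0 ≤ (fun n => (idealNormCount K n : ℂ)) := fun n => by
  simp only [Pi.zero_apply]
  exact_mod_cast Nat.zero_le _

/-- `Λ_K(0) = 0`. [folklore] -/
theorem vonMangoldtIdeal_zero : vonMangoldtIdeal K 0 = 0 := by
  unfold vonMangoldtIdeal
  refine sum_eq_zero fun P _ => ?_
  rw [if_neg]
  simp

/-- `Λ_K(1) = 0`: `1` is not a norm-power `N𝔭^m`, `m ≥ 1` (`N𝔭 ≥ 2`). [folklore] -/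
theorem vonMangoldtIdeal_one : vonMangoldtIdeal K 1 = 0 := by
  unfold vonMangoldtIdeal
  refine sum_eq_zero fun P hP => ?_
  rw [mem_primeIdealsLE_toFinset] at hP
  have h2 := two_le_absNorm_of_isPrime hP.1 hP.2.1
  rw [if_neg]
  simp only [Icc_self, image_singleton, pow_one, mem_singleton]
  omega

/-- The Dirichlet series of `a = idealNormCount K` converges absolutely for `Re s > 1`. [folklore] -/
theorem LSeriesSummable_idealNormCount {s : ℂ} (hs : 1 < s.re) :
    LSeriesSummable (fun n => (idealNormCount K n : ℂ)) s :=
  LSeriesSummable_dedekindZeta hs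

/-- The abscissa of absolute convergence of `ζ_K` is at most `1`. [folklore] -/
theorem abscissaOfAbsConv_idealNormCount_le :
    LSeries.abscissaOfAbsConv (fun n => (idealNormCount K n : ℂ)) ≤ 1 :=
  LSeries.abscissaOfAbsConv_le_of_forall_lt_LSeriesSummable fun y hy =>
    LSeriesSummable_idealNormCount K (by exact_mod_cast hy)

/-- **`a ⋆ Λ_K = a · log`** as complex sequences (Dirichlet convolution), i.e. the coefficient
identity behind `−ζ_K' = ζ_K · ∑ Λ_K(n) n^{-s}`. [cite: LandauMathAnn1903, §11 p. 668] -/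
theorem idealNormCount_convolution_vonMangoldtIdeal :
    (fun n => (idealNormCount K n : ℂ)) ⍟ (fun n => (vonMangoldtIdeal K n : ℂ)) =
      LSeries.logMul (fun n => (idealNormCount K n : ℂ)) := by
  rw [LSeries.convolution_def]
  ext n
  rcases eq_or_ne n 0 with rfl | hn
  · simp [LSeries.logMul]
  · have h := congrArg (fun x : ℝ => (x : ℂ)) (sum_divisorsAntidiagonal_card_mul_vonMangoldtIdeal (K := K) hn)
    simp only [← card_idealsOfNorm, LSeries.logMul]
    push_cast at h
    rw [h, mul_comm]

/-- `Λ_K(n) ≤ a_n log n` (the term `d = 1` of `a ⋆ Λ_K = a · log`). [folklore] -/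
theorem vonMangoldtIdeal_le_card_mul_log (n : ℕ) :
    vonMangoldtIdeal K n ≤ (idealsOfNorm K n).card * Real.log n := by
  rcases eq_or_ne n 0 with rfl | hn
  · have h : Real.log ((0 : ℕ) : ℝ) = 0 := by simp
    rw [h, mul_zero, vonMangoldtIdeal_zero]
  rw [← sum_divisorsAntidiagonal_card_mul_vonMangoldtIdeal hn]
  have hmem : (1, n) ∈ n.divisorsAntidiagonal := Nat.mem_divisorsAntidiagonal.mpr ⟨one_mul n, hn⟩
  calc vonMangoldtIdeal K n = ((idealsOfNorm K 1).card : ℝ) * vonMangoldtIdeal K n := by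
        rw [idealsOfNorm_one, card_singleton, Nat.cast_one, one_mul]
    _ ≤ ∑ p ∈ n.divisorsAntidiagonal, ((idealsOfNorm K p.1).card : ℝ) * vonMangoldtIdeal K p.2 := by
        rw [← add_sum_erase _ _ hmem]
        refine le_add_of_nonneg_right (sum_nonneg fun p _ => ?_)
        exact mul_nonneg (Nat.cast_nonneg _) (vonMangoldtIdeal_nonneg K _)

/-- `‖Λ_K(n)‖ ≤ ‖log n · a_n‖`. [folklore] -/
theorem norm_vonMangoldtIdeal_le (n : ℕ) :
    ‖(vonMangoldtIdeal K n : ℂ)‖ ≤ ‖LSeries.logMul (fun n => (idealNormCount K n : ℂ)) n‖ := by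
  rw [Complex.norm_real, Real.norm_of_nonneg (vonMangoldtIdeal_nonneg K n), LSeries.logMul, norm_mul,
    ← card_idealsOfNorm, Complex.norm_natCast, ← Complex.natCast_log, Complex.norm_real,
    Real.norm_of_nonneg (Real.log_natCast_nonneg n), mul_comm]
  exact vonMangoldtIdeal_le_card_mul_log K n

/-- The Dirichlet series `∑ Λ_K(n) n^{-s}` converges absolutely for `Re s > 1`. [folklore] -/
theorem LSeriesSummable_vonMangoldtIdeal {s : ℂ} (hs : 1 < s.re) :
    LSeriesSummable (fun n => (vonMangoldtIdeal K n : ℂ)) s := by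
  have habs : LSeries.abscissaOfAbsConv (fun n => (idealNormCount K n : ℂ)) < s.re :=
    lt_of_le_of_lt (abscissaOfAbsConv_idealNormCount_le K) (by exact_mod_cast hs)
  have h : LSeriesSummable (LSeries.logMul (fun n => (idealNormCount K n : ℂ))) s :=
    LSeriesSummable_logMul_of_lt_re habs
  exact Summable.of_norm_bounded h.norm fun n => LSeries.norm_term_le s (norm_vonMangoldtIdeal_le K n)

/-- The abscissa of absolute convergence of `∑ Λ_K(n) n^{-s}` is at most `1`. [folklore] -/
theorem abscissaOfAbsConv_vonMangoldtIdeal_le :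
    LSeries.abscissaOfAbsConv (fun n => (vonMangoldtIdeal K n : ℂ)) ≤ 1 :=
  LSeries.abscissaOfAbsConv_le_of_forall_lt_LSeriesSummable fun y hy =>
    LSeriesSummable_vonMangoldtIdeal K (by exact_mod_cast hy)

/-- **`ζ_K'(s) = −ζ_K(s) · ∑ Λ_K(n) n^{-s}`** for `Re s > 1` (Landau 1903, §11).
[cite: LandauMathAnn1903, §11 p. 668] -/
theorem hasDerivAt_dedekindZeta {s : ℂ} (hs : 1 < s.re) :
    HasDerivAt (NumberField.dedekindZeta K)
      (-(NumberField.dedekindZeta K s * LSeries (fun n => (vonMangoldtIdeal K n : ℂ)) s)) s := by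
  have habs : LSeries.abscissaOfAbsConv (fun n => (idealNormCount K n : ℂ)) < s.re :=
    lt_of_le_of_lt (abscissaOfAbsConv_idealNormCount_le K) (by exact_mod_cast hs)
  have h := LSeries_hasDerivAt habs
  have hfun : (LSeries fun n => (idealNormCount K n : ℂ)) = NumberField.dedekindZeta K :=
    funext fun s => (Literature.NumberTheory.LFunctions.dedekindZeta_eq_LSeries K s).symm
  rw [hfun] at h
  rw [← idealNormCount_convolution_vonMangoldtIdeal, LSeries_convolution'
    (LSeriesSummable_idealNormCount K hs) (LSeriesSummable_vonMangoldtIdeal K hs)] at h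
  exact h

/-- `deriv ζ_K (s) = −ζ_K(s) · ∑ Λ_K(n) n^{-s}` for `Re s > 1`. [cite: LandauMathAnn1903, §11 p. 668] -/
theorem deriv_dedekindZeta_eq {s : ℂ} (hs : 1 < s.re) :
    deriv (NumberField.dedekindZeta K) s =
      -(NumberField.dedekindZeta K s * LSeries (fun n => (vonMangoldtIdeal K n : ℂ)) s) :=
  (hasDerivAt_dedekindZeta K hs).deriv

/-- `ζ_K` is analytic on `Re s > 1`. [folklore] -/
theorem analyticOnNhd_dedekindZeta :
    AnalyticOnNhd ℂ (NumberField.dedekindZeta K) {s : ℂ | 1 < s.re} := fun s hs =>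
  LSeries_analyticOnNhd (fun n => (idealNormCount K n : ℂ)) s
    (lt_of_le_of_lt (abscissaOfAbsConv_idealNormCount_le K) (by exact_mod_cast hs))

/-- `ζ_K(x) > 0` for real `x > 1`, as an inequality in `ℂ` for the scoped `ComplexOrder`
(`0 < z ↔ 0 < z.re ∧ z.im = 0`): the value is real and positive. [folklore] -/
theorem dedekindZeta_pos {x : ℝ} (hx : 1 < x) : 0 < NumberField.dedekindZeta K x := by
  rw [Literature.NumberTheory.LFunctions.dedekindZeta_eq_LSeries]
  refine LSeries.positive (idealNormCount_cast_nonneg K)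
    (by rw [idealNormCount_one, Nat.cast_one]; exact zero_lt_one) ?_
  exact lt_of_le_of_lt (abscissaOfAbsConv_idealNormCount_le K) (by exact_mod_cast hx)

/-- **`ζ_K(s) ≠ 0` for `Re s > 1`.** Proof without the Euler product: on a disc around a zero
`s₀`, `ζ_K` solves the linear equation `f' = −L f` with `L = ∑ Λ_K(n) n^{-s}` holomorphic, so
`ζ_K · exp(∫L)` is constant `= 0`, whence `ζ_K ≡ 0` near `s₀`, hence on `Re s > 1` (identity
theorem), contradicting `ζ_K(2) > 0`. [folklore] -/
theorem dedekindZeta_ne_zero_of_one_lt_re {s : ℂ} (hs : 1 < s.re) :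
    NumberField.dedekindZeta K s ≠ 0 := by
  intro h0
  set U : Set ℂ := {z : ℂ | 1 < z.re} with hU
  set Lf : ℂ → ℂ := LSeries (fun n => (vonMangoldtIdeal K n : ℂ)) with hL
  have hUo : IsOpen U := isOpen_lt continuous_const Complex.continuous_re
  obtain ⟨r, hr0, hrU⟩ := Metric.isOpen_iff.mp hUo s hs
  have hLd : DifferentiableOn ℂ Lf (Metric.ball s r) :=
    (LSeries_differentiableOn _).mono fun z hz =>
      lt_of_le_of_lt (abscissaOfAbsConv_vonMangoldtIdeal_le K) (by exact_mod_cast hrU hz)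
  obtain ⟨Φ, hΦ⟩ := hLd.isExactOn_ball
  -- `F = ζ_K · exp Φ` has zero derivative on the disc
  set F : ℂ → ℂ := fun z => NumberField.dedekindZeta K z * Complex.exp (Φ z) with hF
  have hF' : ∀ z ∈ Metric.ball s r, HasDerivAt F 0 z := by
    intro z hz
    have h1 := hasDerivAt_dedekindZeta K (hrU hz)
    have h2 : HasDerivAt (fun w => Complex.exp (Φ w)) (Complex.exp (Φ z) * Lf z) z := (hΦ z hz).cexp
    refine (h1.mul h2).congr_deriv ?_
    rw [hL]
    ring
  have hconst : ∀ z ∈ Metric.ball s r, F z = F s := fun z hz =>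
    Metric.isOpen_ball.is_const_of_deriv_eq_zero (convex_ball s r).isPreconnected
      (fun w hw => (hF' w hw).differentiableAt.differentiableWithinAt)
      (fun w hw => (hF' w hw).deriv) hz (Metric.mem_ball_self hr0)
  have hFs : F s = 0 := by simp [hF, h0]
  have hzero : ∀ z ∈ Metric.ball s r, NumberField.dedekindZeta K z = 0 := fun z hz => by
    have h := hconst z hz
    rw [hFs] at h
    exact (mul_eq_zero.mp h).resolve_right (Complex.exp_ne_zero _)
  -- identity theorem on the (convex) half-plane
  have hev : NumberField.dedekindZeta K =ᶠ[nhds s] 0 :=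
    Filter.eventually_of_mem (Metric.ball_mem_nhds s hr0) hzero
  have hall := (analyticOnNhd_dedekindZeta K).eqOn_zero_of_preconnected_of_eventuallyEq_zero
    (convex_halfSpace_re_gt 1).isPreconnected hs hev
  have h2U : ((2 : ℝ) : ℂ) ∈ U := by
    simp only [hU, Set.mem_setOf_eq, Complex.ofReal_re]
    norm_num
  have h2 := hall h2U
  have hpos := dedekindZeta_pos K (x := 2) (by norm_num)
  simp only [Pi.zero_apply] at h2
  rw [h2] at hpos
  exact lt_irrefl _ hpos

/-- **`−ζ_K'/ζ_K(s) = ∑ Λ_K(n) n⁻ˢ`** for `Re s > 1` (Landau 1903, §11, p. 668: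
"`−ζ_κ'(s)/ζ_κ(s) = ∑ L_κ(n)/nˢ`"). [cite: LandauMathAnn1903, §11 p. 668] -/
theorem neg_logDeriv_dedekindZeta_eq {s : ℂ} (hs : 1 < s.re) :
    -(deriv (NumberField.dedekindZeta K) s / NumberField.dedekindZeta K s) =
      LSeries (fun n => (vonMangoldtIdeal K n : ℂ)) s := by
  rw [deriv_dedekindZeta_eq K hs, neg_div, neg_neg,
    mul_div_cancel_left₀ _ (dedekindZeta_ne_zero_of_one_lt_re K hs)]

end Literature.NumberTheory.LFunctions.NumberField

end
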